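import Literature.AlgebraicGeometry.HodgeTheory.SupportedClassesGysinSpan
import Literature.AlgebraicGeometry.HodgeTheory.ComplexOrientationFamily
import Literature.AlgebraicGeometry.HodgeTheory.HolomorphicBundleChernCharacterTopDegree
import Literature.AlgebraicTopology.SingularHomology.CompactGroupExteriorCohomology
import HarnessLib

/-!
# Route `TropicalKugaSatakeCayley`, crux K2 `KontsevichTransferKS` (stmt-HodgeConjecture-18570), line `birth`:
# STUB 1 `stub_effectiveSpan` — EFFECTIVE SPANNING — proved

The registered stub reads
`∀ {n} (p d) (hdp : d + p = n) (X) (hX : IsSmoothProjective n X),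
  Submodule.span ℂ (effectiveClasses p d hdp X hX) = algebraicClasses X p`,
where the skeleton's `effectiveClasses p d hdp X hX` (file-local to
`Cruxes/KontsevichTransferKS/Lines/birth.lean`) is the set of Gysin images
`g_* 1_V ∈ H²ᵖ(X(ℂ); ℂ)` of the smooth projective `d`-folds `g : V ⟶ X`
(`complexGysin complexOrientationFamily hV hX g (a := 0) (b := 2 * p) _ (singularCohomology.one ℂ V(ℂ))`).
The statement is given here with `effectiveClasses` UNFOLDED
(`kontsevichTransferKS_effectiveSpan`); the registered signature follows by
`fun p d hdp X hX => kontsevichTransferKS_effectiveSpan p d hdp X hX` (definitional unfolding).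

**Mathematics** (Fulton 1998, §19.1 Lemma 19.1.1; Deligne 2000, Remark (vi); Grothendieck 1969,
p. 300): for `X` smooth projective of dimension `n = d + p`, the space of algebraic classes
`Nᵖ H²ᵖ(X(ℂ); ℂ)` is the `ℂ`-span of the cycle classes `g_* 1_V` of the smooth projective
`d`-folds over `X`. Proof on the tree's carriers: Grothendieck's two descriptions of coniveau agree
(`supportedClasses_eq_iSup_range_complexGysin`, from Deligne Hodge III Cor. 8.2.8 and Hironaka, both
theorems of the tree): `Nᵖ H²ᵖ = Σ g_* Hᵃ(Y(ℂ))` over `g : Y ⟶ X`, `dim Y + p ≤ n`,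
`a + 2n = 2p + 2 dim Y`; the degree bookkeeping forces `dim Y = d` and `a = 0`, and
`H⁰(Y(ℂ); ℂ) = ℂ · 1_Y` because `Y(ℂ)` is path connected (`Y` is geometrically irreducible:
`pathConnectedSpace_complexPoints_of_isSmoothProjective`, `singularCohomology.eq_smul_one`), so each
summand is the line `ℂ · g_* 1_Y`. Conversely `g_* 1_V` dies off the closed image `g(V)` of
codimension `p` (`complexGysin_mem_supportedClasses`). Stated for EVERY orientation family `μ`
(`span_complexGysin_one_eq_algebraicClasses`), then specialised to `complexOrientationFamily`.

No definition, no named fact, no sorry.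

## References

* [Fulton1998] W. Fulton, Intersection Theory, 2nd ed. (1998), §19.1, Lemma 19.1.1.
* [Deligne2000] P. Deligne, The Hodge conjecture (Clay, 2000), §1 and Remark (vi).
* [GrothendieckTopology1969] A. Grothendieck, Hodge's general conjecture is false for trivial
  reasons, Topology 8 (1969), §1 and p. 300.
* [DeligneHodgeIII1974] P. Deligne, Théorie de Hodge III, Cor. 8.2.8.
-/

noncomputable section

set_option linter.dupNamespace false

namespace Summit.HodgeConjecture.HodgeConjecture.Theorems

open CategoryTheory AlgebraicGeometry
open Literature.AlgebraicTopology.SingularHomology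
open Literature.AlgebraicGeometry Literature.AlgebraicGeometry.HodgeTheory

variable {n : ℕ} {X : Motives.SchemeOver ℂ}

/-- The Gysin image of `H⁰(V(ℂ); ℂ)` under `g : V ⟶ X`, `V` smooth projective (hence `V(ℂ)` path
connected and `H⁰(V(ℂ); ℂ) = ℂ · 1_V`), is contained in the line `ℂ · g_* 1_V`.
[cite: HatcherAT2002, §3.1 p. 199] -/
theorem range_complexGysin_degree_zero_le_span (μ : OrientationFamily) {d b : ℕ}
    {V : Motives.SchemeOver ℂ} (hV : Motives.IsSmoothProjective d V)
    (hX : Motives.IsSmoothProjective n X) (g : V ⟶ X) (hab : 0 + 2 * n = b + 2 * d) :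
    LinearMap.range (complexGysin μ hV hX g hab) ≤
      Submodule.span ℂ
        {complexGysin μ hV hX g hab (singularCohomology.one ℂ (Motives.ComplexPoints V))} := by
  rintro _ ⟨y, rfl⟩
  haveI := pathConnectedSpace_complexPoints_of_isSmoothProjective hV
  rw [singularCohomology.eq_smul_one ℂ y, map_smul]
  exact Submodule.smul_mem _ _ (Submodule.subset_span rfl)

/-- **Effective spanning, for every orientation family `μ`.** For `X` smooth projective of
dimension `n = d + p`, the algebraic classes `Nᵖ H²ᵖ(X(ℂ); ℂ)` are the `ℂ`-span of the Gysin
images `g_* 1_V` of the smooth projective `d`-folds `g : V ⟶ X`.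
[cite: Fulton1998, §19.1 Lemma 19.1.1] [cite: Deligne2000, §2 Remark (vi)]
[cite: GrothendieckTopology1969, p. 300] -/
theorem span_complexGysin_one_eq_algebraicClasses (μ : OrientationFamily) (p d : ℕ)
    (hdp : d + p = n) (hX : Motives.IsSmoothProjective n X) :
    Submodule.span ℂ
        {c : complexBetti X (2 * p) | ∃ (V : Motives.SchemeOver ℂ)
          (hV : Motives.IsSmoothProjective d V) (g : V ⟶ X),
          c = complexGysin μ hV hX g (a := 0) (b := 2 * p) (by omega)
            (singularCohomology.one ℂ (Motives.ComplexPoints V))} =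
      algebraicClasses X p := by
  apply le_antisymm
  · -- `⊆`: each generator dies off the closed image `g(V)`, of codimension `≥ p`
    refine Submodule.span_le.2 ?_
    rintro c ⟨V, hV, g, rfl⟩
    exact complexGysin_mem_supportedClasses (gysinMap_restrictCompl_eq_zero_of_field ℂ) μ
      μ.hasPoincareDuality hV hX g _ (r := 0) (s := p) (by omega)
      (by rw [supportedClasses_zero]; exact Submodule.mem_top)
  · -- `⊇`: Grothendieck's Gysin description of coniveau `p` in degree `2p`
    change supportedClasses X (2 * p) p ≤ _
    rw [supportedClasses_eq_iSup_range_complexGysin μ hX (2 * p) p]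
    refine iSup_le fun m ↦ iSup_le fun hm ↦ iSup_le fun Y ↦ iSup_le fun hY ↦ iSup_le fun g ↦
      iSup_le fun a ↦ iSup_le fun hab ↦ ?_
    obtain rfl : m = d := by omega
    obtain rfl : a = 0 := by omega
    exact (range_complexGysin_degree_zero_le_span μ hY hX g hab).trans
      (Submodule.span_mono (Set.singleton_subset_iff.2 ⟨Y, hY, g, rfl⟩))

/-- **STUB 1 `stub_effectiveSpan` of line `birth` (crux `KontsevichTransferKS`,
stmt-HodgeConjecture-18570), with the skeleton's `effectiveClasses` unfolded**: for `X` smooth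
projective of dimension `n = d + p`, the `ℂ`-span of the Gysin images `g_* 1_V`
(`complexGysin complexOrientationFamily`) of the smooth projective `d`-folds `g : V ⟶ X` is
`algebraicClasses X p`. The registered signature is
`fun p d hdp X hX => kontsevichTransferKS_effectiveSpan p d hdp X hX`.
[cite: Fulton1998, §19.1 Lemma 19.1.1] [cite: Deligne2000, §2 Remark (vi)] -/
theorem kontsevichTransferKS_effectiveSpan {n : ℕ} (p d : ℕ) (hdp : d + p = n)
    (X : Motives.SchemeOver ℂ) (hX : Motives.IsSmoothProjective n X) :
    Submodule.span ℂ
        {c : complexBetti X (2 * p) | ∃ (V : Motives.SchemeOver ℂ)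
          (hV : Motives.IsSmoothProjective d V) (g : V ⟶ X),
          c = complexGysin complexOrientationFamily hV hX g (a := 0) (b := 2 * p) (by omega)
            (singularCohomology.one ℂ (Motives.ComplexPoints V))} =
      algebraicClasses X p :=
  span_complexGysin_one_eq_algebraicClasses complexOrientationFamily p d hdp hX

end Summit.HodgeConjecture.HodgeConjecture.Theorems

end
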